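import Literature.Algebra.Homology.HyperExt
import Literature.Algebra.Homology.StupidFiltration
import Literature.Algebra.Homology.ExactSequenceTorsion
import HarnessLib

/-!
# Rational ⇒ integral `E₁`-degeneration of the stupid filtration in hyper-Ext

Let `C` be an abelian category with `HasExt.{w} C`, `A : C` a coefficient object and
`K : CochainComplex C ℤ` a complex strictly concentrated in degrees `≥ 0`. The stupid filtration
`⋯ → σ≤(n+1) K → σ≤n K → ⋯ → σ≤0 K → σ≤(-1) K = 0` (`Literature.Algebra.Homology.StupidFiltration`:
`stupidTruncLE`, the short exact sequences `0 → Kⁿ¹[-n₁] → σ≤n₁ K → σ≤n₀ K → 0`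
`stupidFiltrationShortComplex K n₀ n₁ h`, `n₀ + 1 = n₁`) gives long exact sequences of hyper-Ext
groups (`Literature.Algebra.Homology.HyperExt`: `HyperExt.delta`, `exact₁₂₃_apply`) whose
connecting maps
`δ = HyperExt.delta (shortExact_stupidFiltration K n₀ n₁ h) k k' hk :`
`HyperExt A (σ≤n₀ K) k →+ HyperExt A Kⁿ¹[-n₁] k'` (`k + 1 = k'`) package the `E₁`- and all higher
differentials of the first hypercohomology spectral sequence `Ext^{k-n}(A, Kⁿ) ⇒ HyperExt A K k`.
This file turns RATIONAL degeneration (every value of every `δ` is a torsion element) into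
INTEGRAL statements. Everything is proved. As in `Literature.Algebra.Homology.ExactSequenceTorsion`,
"`x` torsion" is spelled `∃ m : ℤ, m ≠ 0 ∧ m • x = 0` and "`G` torsion-free"
`∀ m : ℤ, m ≠ 0 → ∀ x : G, m • x = 0 → x = 0`.

* `HyperExt.map_add_hom`, `map_zsmul_hom`, `map_zsmul_id` (`HyperExt.map` is additive in the
  morphism; `c • 𝟙 K` acts as `c`), `eq_zero_of_isZero`, `map_bijective_of_isIso`.
* `shortExact_stupidFiltration K n₀ n₁ h`: the short exact sequence restated on
  `ShortComplex.mk (singleToStupidTruncLE K n₁) (stupidTruncLEMapOfLE K n₀ n₁ _) _`, whose objects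
  REDUCE to `Kⁿ¹[-n₁]`, `σ≤n₁ K`, `σ≤n₀ K` — always write the connecting maps as
  `HyperExt.delta (shortExact_stupidFiltration K n₀ n₁ h) k k' hk` (with the `def`
  `stupidFiltrationShortComplex` instance search for `HasHyperExt A S.Xᵢ` does not terminate
  quickly). Smallness for the single complexes `Y[-n]` is the HYPOTHESIS
  `[hA : ∀ (n : ℤ) (Y : C), HasHyperExt A ((CochainComplex.singleFunctor C n).obj Y)]` of every
  statement, discharged by `HyperExt.hasHyperExt_singleFunctor_obj A` (consumers: keep the same
  `variable [hA : …]` in scope, or `have hA := HyperExt.hasHyperExt_singleFunctor_obj A` first).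
* **Rational ⇒ integral** `stupidFiltration_delta_eq_zero`: a connecting map with torsion values
  into a torsion-free `HyperExt A Kⁿ¹[-n₁] k'` is zero. Under "`δ = 0`":
  `map_singleToStupidTruncLE_injective`, `exact_map_singleToStupidTruncLE` (always),
  `map_stupidTruncLEMapOfLE_surjective` — the sequences
  `0 → HyperExt A Kⁿ¹[-n₁] k → HyperExt A (σ≤n₁ K) k → HyperExt A (σ≤n₀ K) k → 0` are short exact —
  and, by induction along the tower (`stupidFiltration_induction`),
  `torsionFree_hyperExt_stupidTruncLE`: all `HyperExt A (σ≤n K) k` are torsion-free when the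
  `HyperExt A Kⁿ[-n] k` are. For `K` strictly `≤ b`, `K ⟶ σ≤b K` is an isomorphism
  (`map_stupidTruncLEπ_bijective`), whence `torsionFree_hyperExt_of_stupidFiltration`.
  Summary statement: `stupidFiltration_integral_of_rational`.
* **Naturality** in `K`: `stupidFiltration_delta_naturality` (from `HyperExt.delta_naturality`
  and `stupidFiltrationShortComplexMap`) and the commuting squares
  `map_stupidTruncLEMap_comp_map_singleToStupidTruncLE`, `…_comp_map_stupidTruncLEMapOfLE`,
  `…_comp_map_stupidTruncLEπ` — the input of the transfers and inverse-system statements of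
  `Literature.Algebra.Homology.StupidFiltrationSystems`.

## Why

For a smooth proper formal scheme `𝒳` over `W = W(k)` the Hodge–de Rham spectral sequence (that of
the stupid filtration of `Ω•_{𝒳/W}`) degenerates at `E₁` after `⊗ ℚ` (P. Deligne, *Théorème de
Lefschetz et critères de dégénérescence de suites spectrales*, Publ. Math. IHÉS 35 (1968),
Thm. 5.5: characteristic `0`), i.e. the connecting maps above have torsion values; when the Hodge
groups `H^b(𝒳, Ωʲ)` are torsion-free this upgrades integrally — the remark behind
Bloch–Esnault–Kerz, *`p`-adic deformation of algebraic cycle classes*, Invent. Math. 195 (2014),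
Remarks 35 (1)–(2), and X. Hu, *On the `p`-adic deformation of algebraic cycle classes*,
arXiv:2507.12458, §11, where it is applied to the staircase complexes `p(r)Ω•_{X_N}`.

## Not here

Spectral sequences as such; the complexes `Ω•`, `p(r)Ω•`; the identification of
`HyperExt A Kⁿ[-n] k` with `Ext^{k-n}(A, Kⁿ)` (torsion-freeness / surjectivity hypotheses are
stated for the single complexes `(CochainComplex.singleFunctor C n).obj (K.X n)` directly);
transfers along morphisms and inverse systems (`StupidFiltrationSystems`).
-/

universe w v u

open CategoryTheory Limits

namespace Literature.Algebra.Homology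

/-! ### Complements on `HyperExt.map` -/

namespace HyperExt

variable {C : Type u} [Category.{v} C] [Abelian C]

section Additive

variable {X : C} {K L : CochainComplex C ℤ} [HasHyperExt.{w} X K] [HasHyperExt.{w} X L] {n : ℤ}

/-- `map` is additive in the morphism of complexes: `map (f + g) = map f + map g`. [folklore] -/
theorem map_add_hom (f g : K ⟶ L) (x : HyperExt.{w} X K n) :
    map (f + g) n x = map f n x + map g n x := by
  apply homAddEquiv.injective
  rw [_root_.map_add, homAddEquiv_map, homAddEquiv_map, homAddEquiv_map,
    CategoryTheory.Functor.map_add, CategoryTheory.Functor.map_add, Preadditive.comp_add]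

/-- `map` commutes with integer multiples of the morphism: `map (c • f) = c • map f`.
[folklore] -/
theorem map_zsmul_hom (c : ℤ) (f : K ⟶ L) (x : HyperExt.{w} X K n) :
    map (c • f) n x = c • map f n x := by
  apply homAddEquiv.injective
  rw [_root_.map_zsmul, homAddEquiv_map, homAddEquiv_map, CategoryTheory.Functor.map_zsmul,
    CategoryTheory.Functor.map_zsmul, Preadditive.comp_zsmul]

/-- Multiplication by an integer `c` on a complex acts as multiplication by `c` on its hyper-Ext
groups: `map (c • 𝟙 K) n x = c • x`. [folklore] -/
theorem map_zsmul_id (c : ℤ) (x : HyperExt.{w} X K n) : map (c • 𝟙 K) n x = c • x := by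
  rw [map_zsmul_hom, map_id]

/-- The hyper-Ext groups of a zero complex vanish. [folklore] -/
theorem eq_zero_of_isZero (hK : IsZero K) (x : HyperExt.{w} X K n) : x = 0 :=
  calc x = map (𝟙 K) n x := (map_id x).symm
    _ = 0 := by rw [hK.eq_of_src (𝟙 K) 0, map_zero_hom]

/-- An isomorphism of complexes induces bijections on hyper-Ext groups. [folklore] -/
theorem map_bijective_of_isIso (f : K ⟶ L) [IsIso f] (n : ℤ) :
    Function.Bijective (map (X := X) f n) :=
  (mapEquivOfQuasiIso (X := X) f n).bijective

end Additive

section Single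

variable [HasExt.{w} C] (X : C)

/-- `HyperExt X Y[-n] k` is defined for every single complex `Y[-n] = (singleFunctor C n).obj Y`
(it is cohomologically bounded below): discharges the hypothesis `hA` of
`Literature.Algebra.Homology.StupidFiltrationDegeneration` / `…Systems`. [folklore] -/
theorem hasHyperExt_singleFunctor_obj (n : ℤ) (Y : C) :
    HasHyperExt.{w} X ((CochainComplex.singleFunctor C n).obj Y) :=
  hasHyperExt_of_isGE X _ n

end Single

end HyperExt

section StupidFiltration

variable {C : Type u} [Category.{v} C] [Abelian C]

section ShortExact

variable (K : CochainComplex C ℤ)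

/-- The short exact sequence `0 → Kⁿ¹[-n₁] → σ≤n₁ K → σ≤n₀ K → 0` (`n₀ + 1 = n₁`) of the stupid
filtration (`shortExact_stupidFiltrationShortComplex`), restated for the short complex
`ShortComplex.mk (singleToStupidTruncLE K n₁) (stupidTruncLEMapOfLE K n₀ n₁ _) _` built directly on
its two maps, so that its three objects are *syntactically* `Kⁿ¹[-n₁]`, `σ≤n₁ K`, `σ≤n₀ K` up to
reducible unfolding: this is the form in which instance search finds `HasHyperExt A _` for them,
and THE form in which the connecting maps `HyperExt.delta (shortExact_stupidFiltration K n₀ n₁ h)`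
are written below and should be written by consumers. [folklore] -/
theorem shortExact_stupidFiltration (n₀ n₁ : ℤ) (h : n₀ + 1 = n₁) :
    (ShortComplex.mk (singleToStupidTruncLE K n₁) (stupidTruncLEMapOfLE K n₀ n₁ (by omega))
      (stupidFiltrationShortComplex K n₀ n₁ h).zero).ShortExact :=
  shortExact_stupidFiltrationShortComplex K n₀ n₁ h

end ShortExact

-- `hA`: smallness for the single complexes `Y[-n]`, discharged by
-- `HyperExt.hasHyperExt_singleFunctor_obj A` (kept as a hypothesis: as an instance it would have
-- to take precedence over the generic instance of `HyperExt.lean`, whose search is slow there).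
variable [HasExt.{w} C] (A : C)
  [hA : ∀ (n : ℤ) (Y : C), HasHyperExt.{w} A ((CochainComplex.singleFunctor C n).obj Y)]

/-- **Induction along the stupid filtration** of a complex in degrees `≥ 0`: a property of the
filtration degree `n : ℤ` holding in negative degrees (where `σ≤n K = 0`) and passing from `n₀` to
`n₀ + 1` holds in every degree. [folklore] -/
theorem stupidFiltration_induction {P : ℤ → Prop} (hneg : ∀ n : ℤ, n < 0 → P n)
    (hstep : ∀ n₀ n₁ : ℤ, n₀ + 1 = n₁ → P n₀ → P n₁) (n : ℤ) : P n := by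
  suffices H : ∀ j : ℕ, P ((j : ℤ) - 1) by
    obtain hn | hn := lt_or_ge n 0
    · exact hneg n hn
    · have := H (n + 1).toNat
      rwa [Int.toNat_of_nonneg (by omega), add_sub_cancel_right] at this
  intro j
  induction j with
  | zero => exact hneg _ (by norm_num)
  | succ j ih => exact hstep _ _ (by push_cast; ring) ih

/-! ### (1) Rational ⇒ integral degeneration for one complex -/

section One

variable (K : CochainComplex C ℤ) [K.IsStrictlyGE 0]

omit hA in
/-- In negative filtration degrees the truncations `σ≤n K` (`K` strictly `≥ 0`) vanish, and so do
their hyper-Ext groups. [folklore] -/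
theorem hyperExt_stupidTruncLE_eq_zero_of_neg (n : ℤ) (hn : n < 0) (k : ℤ)
    (x : HyperExt.{w} A (stupidTruncLE K n) k) : x = 0 :=
  HyperExt.eq_zero_of_isZero (isZero_stupidTruncLE K n 0 hn) x

/-- **Rational ⇒ integral, connecting maps.** If every value of the connecting map
`δ : HyperExt A (σ≤n₀ K) k → HyperExt A Kⁿ¹[-n₁] k'` of the stupid filtration is torsion
(rational `E₁`-degeneration) and `HyperExt A Kⁿ¹[-n₁] k'` is torsion-free, then `δ = 0`.
[folklore] -/
theorem stupidFiltration_delta_eq_zero (n₀ n₁ : ℤ) (h : n₀ + 1 = n₁) (k k' : ℤ)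
    (hk : k + 1 = k')
    (hrat : ∀ x : HyperExt.{w} A (stupidTruncLE K n₀) k, ∃ m : ℤ, m ≠ 0 ∧
      m • HyperExt.delta (shortExact_stupidFiltration K n₀ n₁ h) k k' hk x = 0)
    (htf : ∀ m : ℤ, m ≠ 0 →
      ∀ x : HyperExt.{w} A ((CochainComplex.singleFunctor C n₁).obj (K.X n₁)) k',
        m • x = 0 → x = 0) :
    HyperExt.delta (X := A) (shortExact_stupidFiltration K n₀ n₁ h) k k' hk = 0 :=
  eq_zero_of_range_torsion_of_torsionFree _ hrat htf

/-- Exactness of `HyperExt A Kⁿ¹[-n₁] k → HyperExt A (σ≤n₁ K) k → HyperExt A (σ≤n₀ K) k`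
(no hypothesis). [folklore] -/
theorem exact_map_singleToStupidTruncLE (n₀ n₁ : ℤ) (h : n₀ + 1 = n₁) (k : ℤ) :
    Function.Exact (HyperExt.map (X := A) (singleToStupidTruncLE K n₁) k)
      (HyperExt.map (X := A) (stupidTruncLEMapOfLE K n₀ n₁ (by omega)) k) :=
  HyperExt.exact₂_apply A (shortExact_stupidFiltration K n₀ n₁ h) k

/-- If the connecting map `HyperExt A (σ≤n₀ K) k → HyperExt A Kⁿ¹[-n₁] k'` vanishes, then
`HyperExt A Kⁿ¹[-n₁] k' → HyperExt A (σ≤n₁ K) k'` is injective. [folklore] -/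
theorem map_singleToStupidTruncLE_injective (n₀ n₁ : ℤ) (h : n₀ + 1 = n₁) (k k' : ℤ)
    (hk : k + 1 = k')
    (hδ : HyperExt.delta (X := A) (shortExact_stupidFiltration K n₀ n₁ h) k k' hk = 0) :
    Function.Injective (HyperExt.map (X := A) (singleToStupidTruncLE K n₁) k') :=
  injective_of_exact_of_eq_zero
    (HyperExt.exact₁_apply A (shortExact_stupidFiltration K n₀ n₁ h) k k' hk) hδ

/-- If the connecting map `HyperExt A (σ≤n₀ K) k → HyperExt A Kⁿ¹[-n₁] k'` vanishes, then
`HyperExt A (σ≤n₁ K) k → HyperExt A (σ≤n₀ K) k` is surjective. [folklore] -/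
theorem map_stupidTruncLEMapOfLE_surjective (n₀ n₁ : ℤ) (h : n₀ + 1 = n₁) (k k' : ℤ)
    (hk : k + 1 = k')
    (hδ : HyperExt.delta (X := A) (shortExact_stupidFiltration K n₀ n₁ h) k k' hk = 0) :
    Function.Surjective (HyperExt.map (X := A) (stupidTruncLEMapOfLE K n₀ n₁ (by omega)) k) :=
  surjective_of_exact_of_eq_zero
    (HyperExt.exact₃_apply A (shortExact_stupidFiltration K n₀ n₁ h) k k' hk) hδ

/-- **Torsion-freeness along the stupid filtration.** If all connecting maps of the stupid
filtration of `K` vanish on hyper-Ext and all `HyperExt A Kⁿ[-n] k` are torsion-free, then every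
`HyperExt A (σ≤n K) k` is torsion-free (induction on `n`: extensions of torsion-free groups by
torsion-free groups, `torsionFree_of_exact_of_exact`; `σ≤n K = 0` for `n < 0`). [folklore] -/
theorem torsionFree_hyperExt_stupidTruncLE
    (hδ : ∀ (n₀ n₁ : ℤ) (h : n₀ + 1 = n₁) (k k' : ℤ) (hk : k + 1 = k'),
      HyperExt.delta (X := A) (shortExact_stupidFiltration K n₀ n₁ h) k k' hk = 0)
    (htf : ∀ (n k m : ℤ), m ≠ 0 →
      ∀ x : HyperExt.{w} A ((CochainComplex.singleFunctor C n).obj (K.X n)) k, m • x = 0 → x = 0)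
    (n k m : ℤ) (hm : m ≠ 0) (x : HyperExt.{w} A (stupidTruncLE K n) k) (hx : m • x = 0) :
    x = 0 := by
  revert k m
  refine stupidFiltration_induction (P := fun n => ∀ (k m : ℤ), m ≠ 0 →
    ∀ x : HyperExt.{w} A (stupidTruncLE K n) k, m • x = 0 → x = 0) ?_ ?_ n
  · intro n hn k m _ x _
    exact hyperExt_stupidTruncLE_eq_zero_of_neg A K n hn k x
  · intro n₀ n₁ h ih k
    exact torsionFree_of_exact_of_exact
      (HyperExt.exact₁_apply A (shortExact_stupidFiltration K n₀ n₁ h) (k - 1) k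
        (by omega))
      (HyperExt.exact₂_apply A (shortExact_stupidFiltration K n₀ n₁ h) k)
      (fun w => by rw [hδ n₀ n₁ h (k - 1) k (by omega), AddMonoidHom.zero_apply])
      (htf n₁ k) (ih k)

omit hA in
/-- For `K` strictly `≤ n` the projection `K ⟶ σ≤n K` is an isomorphism, hence induces bijections
`HyperExt A K k ≃ HyperExt A (σ≤n K) k`. [folklore] -/
theorem map_stupidTruncLEπ_bijective (n : ℤ) [K.IsStrictlyLE n] (k : ℤ) :
    Function.Bijective (HyperExt.map (X := A) (stupidTruncLEπ K n) k) :=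
  HyperExt.map_bijective_of_isIso _ _

/-- **Torsion-free hyper-Ext from degeneration.** For `K` strictly in degrees `[0, b]`: if all
connecting maps of the stupid filtration vanish on hyper-Ext and all `HyperExt A Kⁿ[-n] k` are
torsion-free, then every `HyperExt A K k` is torsion-free. [folklore] -/
theorem torsionFree_hyperExt_of_stupidFiltration (b : ℤ) [K.IsStrictlyLE b]
    (hδ : ∀ (n₀ n₁ : ℤ) (h : n₀ + 1 = n₁) (k k' : ℤ) (hk : k + 1 = k'),
      HyperExt.delta (X := A) (shortExact_stupidFiltration K n₀ n₁ h) k k' hk = 0)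
    (htf : ∀ (n k m : ℤ), m ≠ 0 →
      ∀ x : HyperExt.{w} A ((CochainComplex.singleFunctor C n).obj (K.X n)) k, m • x = 0 → x = 0)
    (k m : ℤ) (hm : m ≠ 0) (x : HyperExt.{w} A K k) (hx : m • x = 0) : x = 0 :=
  torsionFree_of_injective _ (map_stupidTruncLEπ_bijective A K b k).injective
    (fun m hm y hy => torsionFree_hyperExt_stupidTruncLE A K hδ htf b k m hm y hy) m hm x hx

/-- **Rational ⇒ integral `E₁`-degeneration (summary).** Let `K` be strictly in degrees `≥ 0`.
If every connecting map of the stupid filtration has torsion values on hyper-Ext (rational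
degeneration) and every `HyperExt A Kⁿ[-n] k` is torsion-free, then: all connecting maps vanish;
the sequences `0 → HyperExt A Kⁿ¹[-n₁] k → HyperExt A (σ≤n₁ K) k → HyperExt A (σ≤n₀ K) k → 0`
are short exact; and every `HyperExt A (σ≤n K) k` is torsion-free. [folklore] -/
theorem stupidFiltration_integral_of_rational
    (hrat : ∀ (n₀ n₁ : ℤ) (h : n₀ + 1 = n₁) (k k' : ℤ) (hk : k + 1 = k')
      (x : HyperExt.{w} A (stupidTruncLE K n₀) k), ∃ m : ℤ, m ≠ 0 ∧
        m • HyperExt.delta (shortExact_stupidFiltration K n₀ n₁ h) k k' hk x = 0)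
    (htf : ∀ (n k m : ℤ), m ≠ 0 →
      ∀ x : HyperExt.{w} A ((CochainComplex.singleFunctor C n).obj (K.X n)) k, m • x = 0 → x = 0) :
    (∀ (n₀ n₁ : ℤ) (h : n₀ + 1 = n₁) (k k' : ℤ) (hk : k + 1 = k'),
      HyperExt.delta (X := A) (shortExact_stupidFiltration K n₀ n₁ h) k k' hk = 0) ∧
    (∀ (n₀ n₁ : ℤ) (_ : n₀ + 1 = n₁) (k : ℤ),
      Function.Injective (HyperExt.map (X := A) (singleToStupidTruncLE K n₁) k) ∧
      Function.Exact (HyperExt.map (X := A) (singleToStupidTruncLE K n₁) k)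
        (HyperExt.map (X := A) (stupidTruncLEMapOfLE K n₀ n₁ (by omega)) k) ∧
      Function.Surjective (HyperExt.map (X := A) (stupidTruncLEMapOfLE K n₀ n₁ (by omega)) k)) ∧
    (∀ (n k m : ℤ), m ≠ 0 → ∀ x : HyperExt.{w} A (stupidTruncLE K n) k, m • x = 0 → x = 0) := by
  have hδ : ∀ (n₀ n₁ : ℤ) (h : n₀ + 1 = n₁) (k k' : ℤ) (hk : k + 1 = k'),
      HyperExt.delta (X := A) (shortExact_stupidFiltration K n₀ n₁ h) k k' hk = 0 :=
    fun n₀ n₁ h k k' hk => stupidFiltration_delta_eq_zero A K n₀ n₁ h k k' hk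
      (hrat n₀ n₁ h k k' hk) (htf n₁ k')
  exact ⟨hδ, fun n₀ n₁ h k => ⟨map_singleToStupidTruncLE_injective A K n₀ n₁ h (k - 1) k
    (by omega) (hδ n₀ n₁ h _ _ _), exact_map_singleToStupidTruncLE A K n₀ n₁ h k,
    map_stupidTruncLEMapOfLE_surjective A K n₀ n₁ h k (k + 1) rfl (hδ n₀ n₁ h _ _ _)⟩,
    fun n k m hm x hx => torsionFree_hyperExt_stupidTruncLE A K hδ htf n k m hm x hx⟩

end One

/-! ### Naturality in the complex -/

section Naturality

variable {K L : CochainComplex C ℤ} [K.IsStrictlyGE 0] [L.IsStrictlyGE 0] (φ : K ⟶ L)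

/-- **Naturality of the connecting maps of the stupid filtration** in the complex: for
`φ : K ⟶ L`, `δ_L ∘ HyperExt.map (σ≤n₀ φ) = HyperExt.map (φⁿ¹[-n₁]) ∘ δ_K`. [folklore] -/
theorem stupidFiltration_delta_naturality (n₀ n₁ : ℤ) (h : n₀ + 1 = n₁) (k k' : ℤ)
    (hk : k + 1 = k') (x : HyperExt.{w} A (stupidTruncLE K n₀) k) :
    HyperExt.delta (shortExact_stupidFiltration L n₀ n₁ h) k k' hk
        (HyperExt.map (stupidTruncLEMap φ n₀) k x) =
      HyperExt.map ((CochainComplex.singleFunctor C n₁).map (φ.f n₁)) k'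
        (HyperExt.delta (shortExact_stupidFiltration K n₀ n₁ h) k k' hk x) :=
  HyperExt.delta_naturality (shortExact_stupidFiltration K n₀ n₁ h)
    (shortExact_stupidFiltration L n₀ n₁ h) (stupidFiltrationShortComplexMap φ n₀ n₁ h) k k' hk x

/-- Naturality of the connecting maps, as an equality of composites. [folklore] -/
theorem stupidFiltration_delta_comp_map (n₀ n₁ : ℤ) (h : n₀ + 1 = n₁) (k k' : ℤ)
    (hk : k + 1 = k') :
    (HyperExt.delta (shortExact_stupidFiltration L n₀ n₁ h) k k' hk).comp
        (HyperExt.map (X := A) (stupidTruncLEMap φ n₀) k) =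
      (HyperExt.map ((CochainComplex.singleFunctor C n₁).map (φ.f n₁)) k').comp
        (HyperExt.delta (shortExact_stupidFiltration K n₀ n₁ h) k k' hk) :=
  AddMonoidHom.ext fun x => stupidFiltration_delta_naturality A φ n₀ n₁ h k k' hk x

/-- The square `HyperExt.map (σ≤n φ) ∘ HyperExt.map (Kⁿ[-n] → σ≤n K) =`
`HyperExt.map (Lⁿ[-n] → σ≤n L) ∘ HyperExt.map (φⁿ[-n])` commutes. [folklore] -/
theorem map_stupidTruncLEMap_comp_map_singleToStupidTruncLE (n k : ℤ) :
    (HyperExt.map (X := A) (stupidTruncLEMap φ n) k).comp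
        (HyperExt.map (singleToStupidTruncLE K n) k) =
      (HyperExt.map (singleToStupidTruncLE L n) k).comp
        (HyperExt.map ((CochainComplex.singleFunctor C n).map (φ.f n)) k) := by
  ext x
  simp only [AddMonoidHom.comp_apply, ← HyperExt.map_comp, singleToStupidTruncLE_naturality]

omit hA in
/-- The square `HyperExt.map (σ≤n₀ φ) ∘ HyperExt.map (σ≤n₁ K → σ≤n₀ K) =`
`HyperExt.map (σ≤n₁ L → σ≤n₀ L) ∘ HyperExt.map (σ≤n₁ φ)` commutes. [folklore] -/
theorem map_stupidTruncLEMap_comp_map_stupidTruncLEMapOfLE (n₀ n₁ : ℤ) (h : n₀ ≤ n₁) (k : ℤ) :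
    (HyperExt.map (X := A) (stupidTruncLEMap φ n₀) k).comp
        (HyperExt.map (stupidTruncLEMapOfLE K n₀ n₁ h) k) =
      (HyperExt.map (stupidTruncLEMapOfLE L n₀ n₁ h) k).comp
        (HyperExt.map (stupidTruncLEMap φ n₁) k) := by
  ext x
  simp only [AddMonoidHom.comp_apply, ← HyperExt.map_comp, stupidTruncLEMapOfLE_naturality]

omit hA in
/-- The square `HyperExt.map (σ≤n φ) ∘ HyperExt.map (K → σ≤n K) =`
`HyperExt.map (L → σ≤n L) ∘ HyperExt.map φ` commutes. [folklore] -/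
theorem map_stupidTruncLEMap_comp_map_stupidTruncLEπ (n k : ℤ) :
    (HyperExt.map (X := A) (stupidTruncLEMap φ n) k).comp
        (HyperExt.map (stupidTruncLEπ K n) k) =
      (HyperExt.map (stupidTruncLEπ L n) k).comp (HyperExt.map φ k) := by
  ext x
  simp only [AddMonoidHom.comp_apply, ← HyperExt.map_comp, stupidTruncLEπ_naturality]

end Naturality

end StupidFiltration

end Literature.Algebra.Homology
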